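import Mathlib
import Summits.Ventures.PercRepro2.Defs
import Summits.Ventures.PercRepro2.Independence
import Summits.Ventures.PercRepro2.Harris
import Summits.Ventures.PercRepro2.Graph
import Summits.Ventures.PercRepro2.Events
import Summits.Ventures.PercRepro2.Induced
import Summits.Ventures.PercRepro2.ObsIndependence
import Summits.Ventures.PercRepro2.BHK
import Summits.Ventures.PercRepro2.BHKEvents
import Summits.Ventures.PercRepro2.BHKAvoid
import Summits.Ventures.PercRepro2.BHKPair
import Summits.Ventures.PercRepro2.BHKAntitone

/-!
# A two-cluster four-functions inequality, and the cross-pair inequality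
`P(y ∈ C_s, z ∈ C_t) P(z ∈ C_s, y ∈ C_t) ≤ P(y, z ∈ C_s) P(y, z ∈ C_t)` on `{s ↮ t}`
(blind cell PercRepro2, mine-1 g51; paper proofs/MINE1-LSMPAIRS.md)

With `bhk_antitone_induced` (`BHKAntitone.lean`: antitone cluster functionals multiply on the
meet side of the van den Berg–Häggström–Kahn inequality) and the exploration identity of
`BHKAvoid.lean` (`prob_clusterIn_inter_avoid_eq_expect`: after exploring `C_s = W` the cluster of
`t` is its cluster in `G ∖ W`, so `P(C_s ∈ 𝓤, C_t ∈ 𝓥, s ↮ X) = E[1_𝓤(C_s) g_𝓥(C_s) 1_{s↮X}]` with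
`g_𝓥(W) = P(C_t ∈ 𝓥 in G ∖ W)`, an ANTITONE functional of `W` for an up-set `𝓥`), one gets, for
up-sets `𝓤₁, 𝓤₂` (of the cluster of `s`) and `𝓥₁, 𝓥₂` (of the cluster of `t`) and avoided sets
`X, Y ∋ t`:

  `P(C_s ∈ 𝓤₁, C_t ∈ 𝓥₁, s ↮ X) · P(C_s ∈ 𝓤₂, C_t ∈ 𝓥₂, s ↮ Y)
      ≤ P(C_s ∈ 𝓤₁ ∩ 𝓤₂, s ↮ X ∩ Y) · P(C_t ∈ 𝓥₁ ∩ 𝓥₂, s ↮ X ∪ Y)`      (`BHKAntitoneCross.bhk_two_cluster_four`)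

— the meet term uses Harris in the fibre `G ∖ W` once more (`delClusterProb_mul_le_inter`:
`g_{𝓥₁} g_{𝓥₂} ≤ g_{𝓥₁ ∩ 𝓥₂}`).  Special cases: `𝓥₁ = 𝓥₂ = univ` is van den Berg–Kahn 1.2 for
up-sets; `𝓤₂ = 𝓥₁ = univ`, `X = Y` is BHK06 Thm 1.4 (`bhk_cross_cluster_avoid`); and
`𝓤₁ = {y ∈ ·}, 𝓥₁ = {z ∈ ·}, X = {z, t}`, `𝓤₂ = {z ∈ ·}, 𝓥₂ = {y ∈ ·}, Y = {y, t}` is the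
CROSS-PAIR inequality of the status law on `{s ↮ t}` (`cross_pair_lsm`):

  `P(y ∈ C_s, z ∈ C_t, s ↮ {z, t}) · P(z ∈ C_s, y ∈ C_t, s ↮ {y, t})
      ≤ P(y, z ∈ C_s, s ↮ {z, t} ∩ {y, t}) · P(y, z ∈ C_t, s ↮ {z, t} ∪ {y, t})`,

i.e. `m(ST) m(TS) ≤ m(SS) m(TT)` for the statuses `(σ_y, σ_z)` (`S` = in `C_s`, `T` = in `C_t`)
when `y, z, t` are distinct — the log-supermodular inequality of the pair `(ST, TS)`, which is NOT
in the degree-2 cone of the cell's avoidance-PA facts (exact LP, data/mine-1/g51/).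
-/

namespace Summit.Ventures.PercRepro2

namespace BHKAntitoneCross

section TwoClusterFour

variable {V : Type*} {E : Type*} [Fintype E] [DecidableEq E] [Fintype V] [DecidableEq V]
  {R : Type*} [CommRing R] [LinearOrder R] [IsStrictOrderedRing R]

omit [Fintype V] [DecidableEq V] in
/-- **Harris in the fibre `G ∖ W`**: for up-sets `𝓥₁, 𝓥₂`, `g_{𝓥₁}(W) g_{𝓥₂}(W) ≤ g_{𝓥₁∩𝓥₂}(W)`. -/
lemma delClusterProb_mul_le_inter (p : E → R) (hp : IsProbVec p) (ends : E → Sym2 V) (t : V)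
    {𝓥₁ 𝓥₂ : Set (Set V)} (h𝓥₁ : IsUpperSet 𝓥₁) (h𝓥₂ : IsUpperSet 𝓥₂) (W : Set V) :
    delClusterProb p ends t 𝓥₁ W * delClusterProb p ends t 𝓥₂ W ≤
      delClusterProb p ends t (𝓥₁ ∩ 𝓥₂) W := by
  unfold delClusterProb
  have hup : ∀ {𝓥 : Set (Set V)}, IsUpperSet 𝓥 →
      IsUpperSet {ω : Config E | cluster ends (delConfig ends W ω) t ∈ 𝓥} := by
    intro 𝓥 h𝓥 ω ω' hle hω
    exact h𝓥 (cluster_mono (BHKPair.delConfig_mono_config ends W hle) t) hω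
  have h := prob_mul_prob_le_prob_inter hp (hup h𝓥₁) (hup h𝓥₂)
  refine h.trans (le_of_eq ?_)
  congr 1

/-- **Two-cluster four-functions inequality** (the antitone BHK inequality read through the
exploration of `C_s`): for up-sets `𝓤₁, 𝓤₂` of the cluster of `s`, up-sets `𝓥₁, 𝓥₂` of the cluster
of `t`, and avoided sets `X, Y ∋ t`,
`P(C_s ∈ 𝓤₁, C_t ∈ 𝓥₁, s↮X) · P(C_s ∈ 𝓤₂, C_t ∈ 𝓥₂, s↮Y)
  ≤ P(C_s ∈ 𝓤₁ ∩ 𝓤₂, s↮X∩Y) · P(C_t ∈ 𝓥₁ ∩ 𝓥₂, s↮X∪Y)`. -/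
theorem bhk_two_cluster_four (p : E → R) (hp : IsProbVec p) (ends : E → Sym2 V) (s t : V)
    {X Y : Finset V} (htX : t ∈ X) (htY : t ∈ Y) {𝓤₁ 𝓤₂ 𝓥₁ 𝓥₂ : Set (Set V)}
    (h𝓤₁ : IsUpperSet 𝓤₁) (h𝓤₂ : IsUpperSet 𝓤₂) (h𝓥₁ : IsUpperSet 𝓥₁) (h𝓥₂ : IsUpperSet 𝓥₂) :
    prob p (clusterInEvent ends s 𝓤₁ ∩ clusterInEvent ends t 𝓥₁ ∩ avoidAll ends s X) *
        prob p (clusterInEvent ends s 𝓤₂ ∩ clusterInEvent ends t 𝓥₂ ∩ avoidAll ends s Y) ≤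
      prob p (clusterInEvent ends s (𝓤₁ ∩ 𝓤₂) ∩ avoidAll ends s (X ∩ Y)) *
        prob p (clusterInEvent ends t (𝓥₁ ∩ 𝓥₂) ∩ avoidAll ends s (X ∪ Y)) := by
  classical
  -- the three exploration identities
  have e1 := prob_clusterIn_inter_avoid_eq_expect p ends s t htX 𝓤₁ 𝓥₁
  have e2 := prob_clusterIn_inter_avoid_eq_expect p ends s t htY 𝓤₂ 𝓥₂
  have htXY : t ∈ X ∪ Y := Finset.mem_union_left Y htX
  have e4 := prob_clusterIn_inter_avoid_eq_expect p ends s t htXY Set.univ (𝓥₁ ∩ 𝓥₂)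
  simp only [Set.indicator_univ, Pi.one_apply, one_mul] at e4
  have e4' : clusterInEvent ends s Set.univ ∩ clusterInEvent ends t (𝓥₁ ∩ 𝓥₂) ∩
      avoidAll ends s (X ∪ Y) = clusterInEvent ends t (𝓥₁ ∩ 𝓥₂) ∩ avoidAll ends s (X ∪ Y) := by
    ext ω; simp [clusterInEvent]
  rw [e4'] at e4
  have e3 := prob_clusterInEvent_inter_eq_expect p ends s (𝓤₁ ∩ 𝓤₂) (avoidAll ends s (X ∩ Y))
  -- the functionals
  have hF₁ : Monotone (𝓤₁.indicator (1 : Set V → R)) := monotone_indicator_one_of_isUpperSet h𝓤₁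
  have hF₂ : Monotone (𝓤₂.indicator (1 : Set V → R)) := monotone_indicator_one_of_isUpperSet h𝓤₂
  have hD₁ : Antitone (delClusterProb p ends t 𝓥₁) := delClusterProb_anti p hp ends t h𝓥₁
  have hD₂ : Antitone (delClusterProb p ends t 𝓥₂) := delClusterProb_anti p hp ends t h𝓥₂
  have hF₁0 : ∀ W, 0 ≤ 𝓤₁.indicator (1 : Set V → R) W :=
    fun W => Set.indicator_apply_nonneg fun _ => zero_le_one
  have hF₂0 : ∀ W, 0 ≤ 𝓤₂.indicator (1 : Set V → R) W :=
    fun W => Set.indicator_apply_nonneg fun _ => zero_le_one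
  have hD₁0 : ∀ W, 0 ≤ delClusterProb p ends t 𝓥₁ W := delClusterProb_nonneg p hp ends t 𝓥₁
  have hD₂0 : ∀ W, 0 ≤ delClusterProb p ends t 𝓥₂ W := delClusterProb_nonneg p hp ends t 𝓥₂
  have key := bhk_antitone_induced p hp ends s hF₁ hF₂ hD₁ hD₂ hF₁0 hF₂0 hD₁0 hD₂0 Finset.univ
    X Y (Finset.subset_univ _) (Finset.subset_univ _)
  simp only [REvent_univ] at key
  have e : ∀ (F : Set V → R) (A : Set (Config E)),
      clusterObs ends Finset.univ s F * A.indicator 1 =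
        fun ω => F (cluster ends ω s) * A.indicator 1 ω := by
    intro F A
    funext ω
    simp only [Pi.mul_apply, clusterObs_apply, clusterIn_univ]
  rw [e, e, e, e] at key
  simp only [Pi.mul_apply] at key
  -- the left side
  have eL₁ : expect p (fun ω => 𝓤₁.indicator (1 : Set V → R) (cluster ends ω s) *
      delClusterProb p ends t 𝓥₁ (cluster ends ω s) * (avoidAll ends s X).indicator 1 ω) =
      prob p (clusterInEvent ends s 𝓤₁ ∩ clusterInEvent ends t 𝓥₁ ∩ avoidAll ends s X) := e1.symm
  have eL₂ : expect p (fun ω => 𝓤₂.indicator (1 : Set V → R) (cluster ends ω s) *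
      delClusterProb p ends t 𝓥₂ (cluster ends ω s) * (avoidAll ends s Y).indicator 1 ω) =
      prob p (clusterInEvent ends s 𝓤₂ ∩ clusterInEvent ends t 𝓥₂ ∩ avoidAll ends s Y) := e2.symm
  -- the join term: `1_{𝓤₁} 1_{𝓤₂} = 1_{𝓤₁ ∩ 𝓤₂}`
  have eJ : expect p (fun ω => 𝓤₁.indicator (1 : Set V → R) (cluster ends ω s) *
      𝓤₂.indicator (1 : Set V → R) (cluster ends ω s) * (avoidAll ends s (X ∩ Y)).indicator 1 ω) =
      prob p (clusterInEvent ends s (𝓤₁ ∩ 𝓤₂) ∩ avoidAll ends s (X ∩ Y)) := by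
    rw [e3]
    congr 1
    funext ω
    congr 1
    by_cases h1 : cluster ends ω s ∈ 𝓤₁ <;> by_cases h2 : cluster ends ω s ∈ 𝓤₂ <;>
      simp [h1, h2]
  -- the meet term: Harris in the fibre
  have eM : expect p (fun ω => delClusterProb p ends t 𝓥₁ (cluster ends ω s) *
      delClusterProb p ends t 𝓥₂ (cluster ends ω s) * (avoidAll ends s (X ∪ Y)).indicator 1 ω) ≤
      prob p (clusterInEvent ends t (𝓥₁ ∩ 𝓥₂) ∩ avoidAll ends s (X ∪ Y)) := by
    rw [e4]
    refine expect_mono hp fun ω => ?_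
    refine mul_le_mul_of_nonneg_right (delClusterProb_mul_le_inter p hp ends t h𝓥₁ h𝓥₂ _) ?_
    exact Set.indicator_apply_nonneg fun _ => zero_le_one
  rw [eL₁, eL₂, eJ] at key
  refine key.trans (mul_le_mul_of_nonneg_left eM (prob_nonneg hp _))

omit [Fintype V] [DecidableEq V] in
/-- For a down-set `𝓦`, `g_𝓦` is monotone in `W` (a larger explored cluster leaves a smaller
cluster of `t`, which stays in a down-set). -/
lemma delClusterProb_mono_of_isLowerSet (p : E → R) (hp : IsProbVec p) (ends : E → Sym2 V)
    (t : V) {𝓦 : Set (Set V)} (h𝓦 : IsLowerSet 𝓦) : Monotone (delClusterProb p ends t 𝓦) := by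
  intro W W' h
  unfold delClusterProb
  refine prob_mono hp fun ω hω => ?_
  exact h𝓦 (cluster_mono (delConfig_anti h ω) t) hω

omit [Fintype V] [DecidableEq V] in
/-- **Harris in the fibre, mixed form**: for an up-set `𝓥` and a down-set `𝓦`,
`g_{𝓥∩𝓦}(W) ≤ g_𝓥(W) g_𝓦(W)`. -/
lemma delClusterProb_inter_le_mul (p : E → R) (hp : IsProbVec p) (ends : E → Sym2 V) (t : V)
    {𝓥 𝓦 : Set (Set V)} (h𝓥 : IsUpperSet 𝓥) (h𝓦 : IsLowerSet 𝓦) (W : Set V) :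
    delClusterProb p ends t (𝓥 ∩ 𝓦) W ≤
      delClusterProb p ends t 𝓥 W * delClusterProb p ends t 𝓦 W := by
  unfold delClusterProb
  have hup : IsUpperSet {ω : Config E | cluster ends (delConfig ends W ω) t ∈ 𝓥} :=
    fun ω ω' hle hω => h𝓥 (cluster_mono (BHKPair.delConfig_mono_config ends W hle) t) hω
  have hlo : IsLowerSet {ω : Config E | cluster ends (delConfig ends W ω) t ∈ 𝓦} :=
    fun ω ω' hle hω => h𝓦 (cluster_mono (BHKPair.delConfig_mono_config ends W hle) t) hω
  have h := prob_inter_le_prob_mul_prob_of_isLowerSet hp hlo hup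
  rw [mul_comm] at h
  refine le_of_eq_of_le ?_ h
  congr 1
  ext ω
  simp only [Set.mem_setOf_eq, Set.mem_inter_iff]
  tauto

omit [Fintype V] [DecidableEq V] in
/-- **Harris in the fibre for down-sets**: `g_{𝓦₁}(W) g_{𝓦₂}(W) ≤ g_{𝓦₁∩𝓦₂}(W)`. -/
lemma delClusterProb_mul_le_inter_of_isLowerSet (p : E → R) (hp : IsProbVec p)
    (ends : E → Sym2 V) (t : V) {𝓦₁ 𝓦₂ : Set (Set V)} (h𝓦₁ : IsLowerSet 𝓦₁)
    (h𝓦₂ : IsLowerSet 𝓦₂) (W : Set V) :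
    delClusterProb p ends t 𝓦₁ W * delClusterProb p ends t 𝓦₂ W ≤
      delClusterProb p ends t (𝓦₁ ∩ 𝓦₂) W := by
  unfold delClusterProb
  have hlo : ∀ {𝓦 : Set (Set V)}, IsLowerSet 𝓦 →
      IsLowerSet {ω : Config E | cluster ends (delConfig ends W ω) t ∈ 𝓦} := by
    intro 𝓦 h𝓦 ω ω' hle hω
    exact h𝓦 (cluster_mono (BHKPair.delConfig_mono_config ends W hle) t) hω
  have h := prob_mul_prob_le_prob_inter_of_isLowerSet hp (hlo h𝓦₁) (hlo h𝓦₂)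
  refine h.trans (le_of_eq ?_)
  congr 1

/-- **Two-cluster four-functions inequality with down-sets of the second cluster**: for up-sets
`𝓤₁, 𝓤₂` of the cluster of `s`, up-sets `𝓥₁, 𝓥₂` and down-sets `𝓦₁, 𝓦₂` of the cluster of `t`,
and avoided sets `X, Y ∋ t`,
`P(C_s ∈ 𝓤₁, C_t ∈ 𝓥₁∩𝓦₁, s↮X) · P(C_s ∈ 𝓤₂, C_t ∈ 𝓥₂∩𝓦₂, s↮Y)
  ≤ P(C_s ∈ 𝓤₁∩𝓤₂, C_t ∈ 𝓦₁∩𝓦₂, s↮X∩Y) · P(C_t ∈ 𝓥₁∩𝓥₂, s↮X∪Y)`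
(up-sets of the unexplored cluster go to the meet, down-sets to the join). -/
theorem bhk_two_cluster_four' (p : E → R) (hp : IsProbVec p) (ends : E → Sym2 V) (s t : V)
    {X Y : Finset V} (htX : t ∈ X) (htY : t ∈ Y) {𝓤₁ 𝓤₂ 𝓥₁ 𝓥₂ 𝓦₁ 𝓦₂ : Set (Set V)}
    (h𝓤₁ : IsUpperSet 𝓤₁) (h𝓤₂ : IsUpperSet 𝓤₂) (h𝓥₁ : IsUpperSet 𝓥₁) (h𝓥₂ : IsUpperSet 𝓥₂)
    (h𝓦₁ : IsLowerSet 𝓦₁) (h𝓦₂ : IsLowerSet 𝓦₂) :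
    prob p (clusterInEvent ends s 𝓤₁ ∩ clusterInEvent ends t (𝓥₁ ∩ 𝓦₁) ∩ avoidAll ends s X) *
        prob p (clusterInEvent ends s 𝓤₂ ∩ clusterInEvent ends t (𝓥₂ ∩ 𝓦₂) ∩
          avoidAll ends s Y) ≤
      prob p (clusterInEvent ends s (𝓤₁ ∩ 𝓤₂) ∩ clusterInEvent ends t (𝓦₁ ∩ 𝓦₂) ∩
          avoidAll ends s (X ∩ Y)) *
        prob p (clusterInEvent ends t (𝓥₁ ∩ 𝓥₂) ∩ avoidAll ends s (X ∪ Y)) := by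
  classical
  have htXY : t ∈ X ∩ Y := Finset.mem_inter.2 ⟨htX, htY⟩
  have htXY' : t ∈ X ∪ Y := Finset.mem_union_left Y htX
  -- the exploration identities
  have e1 := prob_clusterIn_inter_avoid_eq_expect p ends s t htX 𝓤₁ (𝓥₁ ∩ 𝓦₁)
  have e2 := prob_clusterIn_inter_avoid_eq_expect p ends s t htY 𝓤₂ (𝓥₂ ∩ 𝓦₂)
  have e3 := prob_clusterIn_inter_avoid_eq_expect p ends s t htXY (𝓤₁ ∩ 𝓤₂) (𝓦₁ ∩ 𝓦₂)
  have e4 := prob_clusterIn_inter_avoid_eq_expect p ends s t htXY' Set.univ (𝓥₁ ∩ 𝓥₂)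
  simp only [Set.indicator_univ, Pi.one_apply, one_mul] at e4
  have e4' : clusterInEvent ends s Set.univ ∩ clusterInEvent ends t (𝓥₁ ∩ 𝓥₂) ∩
      avoidAll ends s (X ∪ Y) = clusterInEvent ends t (𝓥₁ ∩ 𝓥₂) ∩ avoidAll ends s (X ∪ Y) := by
    ext ω; simp [clusterInEvent]
  rw [e4'] at e4
  -- the functionals
  have nI : ∀ (𝓤 : Set (Set V)) (W : Set V), 0 ≤ 𝓤.indicator (1 : Set V → R) W :=
    fun 𝓤 W => Set.indicator_apply_nonneg fun _ => zero_le_one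
  have nA : ∀ (A : Set (Config E)) (ω : Config E), 0 ≤ A.indicator (1 : Config E → R) ω :=
    fun A ω => Set.indicator_apply_nonneg fun _ => zero_le_one
  have mW₁ := delClusterProb_mono_of_isLowerSet p hp ends t h𝓦₁
  have mW₂ := delClusterProb_mono_of_isLowerSet p hp ends t h𝓦₂
  have hF₁ : Monotone (𝓤₁.indicator (1 : Set V → R) * delClusterProb p ends t 𝓦₁) := by
    intro W W' h
    simp only [Pi.mul_apply]
    exact mul_le_mul (monotone_indicator_one_of_isUpperSet h𝓤₁ h) (mW₁ h)
      (delClusterProb_nonneg p hp ends t 𝓦₁ W) (nI 𝓤₁ W')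
  have hF₂ : Monotone (𝓤₂.indicator (1 : Set V → R) * delClusterProb p ends t 𝓦₂) := by
    intro W W' h
    simp only [Pi.mul_apply]
    exact mul_le_mul (monotone_indicator_one_of_isUpperSet h𝓤₂ h) (mW₂ h)
      (delClusterProb_nonneg p hp ends t 𝓦₂ W) (nI 𝓤₂ W')
  have hD₁ : Antitone (delClusterProb p ends t 𝓥₁) := delClusterProb_anti p hp ends t h𝓥₁
  have hD₂ : Antitone (delClusterProb p ends t 𝓥₂) := delClusterProb_anti p hp ends t h𝓥₂
  have hF₁0 : ∀ W, 0 ≤ (𝓤₁.indicator (1 : Set V → R) * delClusterProb p ends t 𝓦₁) W :=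
    fun W => mul_nonneg (nI 𝓤₁ W) (delClusterProb_nonneg p hp ends t 𝓦₁ W)
  have hF₂0 : ∀ W, 0 ≤ (𝓤₂.indicator (1 : Set V → R) * delClusterProb p ends t 𝓦₂) W :=
    fun W => mul_nonneg (nI 𝓤₂ W) (delClusterProb_nonneg p hp ends t 𝓦₂ W)
  have hD₁0 : ∀ W, 0 ≤ delClusterProb p ends t 𝓥₁ W := delClusterProb_nonneg p hp ends t 𝓥₁
  have hD₂0 : ∀ W, 0 ≤ delClusterProb p ends t 𝓥₂ W := delClusterProb_nonneg p hp ends t 𝓥₂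
  have key := bhk_antitone_induced p hp ends s hF₁ hF₂ hD₁ hD₂ hF₁0 hF₂0 hD₁0 hD₂0 Finset.univ
    X Y (Finset.subset_univ _) (Finset.subset_univ _)
  simp only [REvent_univ] at key
  have e : ∀ (F : Set V → R) (A : Set (Config E)),
      clusterObs ends Finset.univ s F * A.indicator 1 =
        fun ω => F (cluster ends ω s) * A.indicator 1 ω := by
    intro F A
    funext ω
    simp only [Pi.mul_apply, clusterObs_apply, clusterIn_univ]
  rw [e, e, e, e] at key
  simp only [Pi.mul_apply] at key
  -- the left side: each factor is bounded above by Harris in the fibre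
  have eL₁ : prob p (clusterInEvent ends s 𝓤₁ ∩ clusterInEvent ends t (𝓥₁ ∩ 𝓦₁) ∩
      avoidAll ends s X) ≤ expect p (fun ω => 𝓤₁.indicator (1 : Set V → R) (cluster ends ω s) *
        delClusterProb p ends t 𝓦₁ (cluster ends ω s) *
        delClusterProb p ends t 𝓥₁ (cluster ends ω s) * (avoidAll ends s X).indicator 1 ω) := by
    rw [e1]
    refine expect_mono hp fun ω => ?_
    refine mul_le_mul_of_nonneg_right ?_ (nA _ ω)
    calc 𝓤₁.indicator (1 : Set V → R) (cluster ends ω s) *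
          delClusterProb p ends t (𝓥₁ ∩ 𝓦₁) (cluster ends ω s)
        ≤ 𝓤₁.indicator (1 : Set V → R) (cluster ends ω s) *
          (delClusterProb p ends t 𝓥₁ (cluster ends ω s) *
            delClusterProb p ends t 𝓦₁ (cluster ends ω s)) :=
          mul_le_mul_of_nonneg_left (delClusterProb_inter_le_mul p hp ends t h𝓥₁ h𝓦₁ _) (nI _ _)
      _ = _ := by ring
  have eL₂ : prob p (clusterInEvent ends s 𝓤₂ ∩ clusterInEvent ends t (𝓥₂ ∩ 𝓦₂) ∩
      avoidAll ends s Y) ≤ expect p (fun ω => 𝓤₂.indicator (1 : Set V → R) (cluster ends ω s) *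
        delClusterProb p ends t 𝓦₂ (cluster ends ω s) *
        delClusterProb p ends t 𝓥₂ (cluster ends ω s) * (avoidAll ends s Y).indicator 1 ω) := by
    rw [e2]
    refine expect_mono hp fun ω => ?_
    refine mul_le_mul_of_nonneg_right ?_ (nA _ ω)
    calc 𝓤₂.indicator (1 : Set V → R) (cluster ends ω s) *
          delClusterProb p ends t (𝓥₂ ∩ 𝓦₂) (cluster ends ω s)
        ≤ 𝓤₂.indicator (1 : Set V → R) (cluster ends ω s) *
          (delClusterProb p ends t 𝓥₂ (cluster ends ω s) *
            delClusterProb p ends t 𝓦₂ (cluster ends ω s)) :=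
          mul_le_mul_of_nonneg_left (delClusterProb_inter_le_mul p hp ends t h𝓥₂ h𝓦₂ _) (nI _ _)
      _ = _ := by ring
  -- the join term: `1_{𝓤₁} 1_{𝓤₂} = 1_{𝓤₁∩𝓤₂}` and Harris for the down-sets in the fibre
  have eJ : expect p (fun ω => 𝓤₁.indicator (1 : Set V → R) (cluster ends ω s) *
      delClusterProb p ends t 𝓦₁ (cluster ends ω s) *
      (𝓤₂.indicator (1 : Set V → R) (cluster ends ω s) *
        delClusterProb p ends t 𝓦₂ (cluster ends ω s)) *
      (avoidAll ends s (X ∩ Y)).indicator 1 ω) ≤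
      prob p (clusterInEvent ends s (𝓤₁ ∩ 𝓤₂) ∩ clusterInEvent ends t (𝓦₁ ∩ 𝓦₂) ∩
        avoidAll ends s (X ∩ Y)) := by
    rw [e3]
    refine expect_mono hp fun ω => ?_
    refine mul_le_mul_of_nonneg_right ?_ (nA _ ω)
    have hind : 𝓤₁.indicator (1 : Set V → R) (cluster ends ω s) *
        𝓤₂.indicator (1 : Set V → R) (cluster ends ω s) =
        (𝓤₁ ∩ 𝓤₂).indicator (1 : Set V → R) (cluster ends ω s) := by
      by_cases h1 : cluster ends ω s ∈ 𝓤₁ <;> by_cases h2 : cluster ends ω s ∈ 𝓤₂ <;>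
        simp [h1, h2]
    calc 𝓤₁.indicator (1 : Set V → R) (cluster ends ω s) *
          delClusterProb p ends t 𝓦₁ (cluster ends ω s) *
          (𝓤₂.indicator (1 : Set V → R) (cluster ends ω s) *
            delClusterProb p ends t 𝓦₂ (cluster ends ω s))
        = (𝓤₁.indicator (1 : Set V → R) (cluster ends ω s) *
            𝓤₂.indicator (1 : Set V → R) (cluster ends ω s)) *
          (delClusterProb p ends t 𝓦₁ (cluster ends ω s) *
            delClusterProb p ends t 𝓦₂ (cluster ends ω s)) := by ring
      _ ≤ (𝓤₁ ∩ 𝓤₂).indicator (1 : Set V → R) (cluster ends ω s) *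
          delClusterProb p ends t (𝓦₁ ∩ 𝓦₂) (cluster ends ω s) := by
          rw [hind]
          exact mul_le_mul_of_nonneg_left
            (delClusterProb_mul_le_inter_of_isLowerSet p hp ends t h𝓦₁ h𝓦₂ _) (nI _ _)
  -- the meet term: Harris for the up-sets in the fibre
  have eM : expect p (fun ω => delClusterProb p ends t 𝓥₁ (cluster ends ω s) *
      delClusterProb p ends t 𝓥₂ (cluster ends ω s) * (avoidAll ends s (X ∪ Y)).indicator 1 ω) ≤
      prob p (clusterInEvent ends t (𝓥₁ ∩ 𝓥₂) ∩ avoidAll ends s (X ∪ Y)) := by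
    rw [e4]
    refine expect_mono hp fun ω => ?_
    refine mul_le_mul_of_nonneg_right (delClusterProb_mul_le_inter p hp ends t h𝓥₁ h𝓥₂ _) ?_
    exact nA _ ω
  have nL₂ : 0 ≤ prob p (clusterInEvent ends s 𝓤₂ ∩ clusterInEvent ends t (𝓥₂ ∩ 𝓦₂) ∩
      avoidAll ends s Y) := prob_nonneg hp _
  have nR₁ : 0 ≤ expect p (fun ω => 𝓤₁.indicator (1 : Set V → R) (cluster ends ω s) *
      delClusterProb p ends t 𝓦₁ (cluster ends ω s) *
      delClusterProb p ends t 𝓥₁ (cluster ends ω s) * (avoidAll ends s X).indicator 1 ω) :=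
    expect_nonneg hp fun ω => mul_nonneg (mul_nonneg (mul_nonneg (nI _ _)
      (delClusterProb_nonneg p hp ends t 𝓦₁ _)) (delClusterProb_nonneg p hp ends t 𝓥₁ _)) (nA _ ω)
  have nM : 0 ≤ expect p (fun ω => delClusterProb p ends t 𝓥₁ (cluster ends ω s) *
      delClusterProb p ends t 𝓥₂ (cluster ends ω s) * (avoidAll ends s (X ∪ Y)).indicator 1 ω) :=
    expect_nonneg hp fun ω => mul_nonneg (mul_nonneg (delClusterProb_nonneg p hp ends t 𝓥₁ _)
      (delClusterProb_nonneg p hp ends t 𝓥₂ _)) (nA _ ω)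
  have nJ : 0 ≤ prob p (clusterInEvent ends s (𝓤₁ ∩ 𝓤₂) ∩ clusterInEvent ends t (𝓦₁ ∩ 𝓦₂) ∩
      avoidAll ends s (X ∩ Y)) := prob_nonneg hp _
  calc prob p (clusterInEvent ends s 𝓤₁ ∩ clusterInEvent ends t (𝓥₁ ∩ 𝓦₁) ∩ avoidAll ends s X) *
        prob p (clusterInEvent ends s 𝓤₂ ∩ clusterInEvent ends t (𝓥₂ ∩ 𝓦₂) ∩ avoidAll ends s Y)
      ≤ expect p (fun ω => 𝓤₁.indicator (1 : Set V → R) (cluster ends ω s) *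
            delClusterProb p ends t 𝓦₁ (cluster ends ω s) *
            delClusterProb p ends t 𝓥₁ (cluster ends ω s) * (avoidAll ends s X).indicator 1 ω) *
          expect p (fun ω => 𝓤₂.indicator (1 : Set V → R) (cluster ends ω s) *
            delClusterProb p ends t 𝓦₂ (cluster ends ω s) *
            delClusterProb p ends t 𝓥₂ (cluster ends ω s) * (avoidAll ends s Y).indicator 1 ω) :=
        mul_le_mul eL₁ eL₂ nL₂ nR₁
    _ ≤ expect p (fun ω => 𝓤₁.indicator (1 : Set V → R) (cluster ends ω s) *
            delClusterProb p ends t 𝓦₁ (cluster ends ω s) *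
            (𝓤₂.indicator (1 : Set V → R) (cluster ends ω s) *
              delClusterProb p ends t 𝓦₂ (cluster ends ω s)) *
            (avoidAll ends s (X ∩ Y)).indicator 1 ω) *
          expect p (fun ω => delClusterProb p ends t 𝓥₁ (cluster ends ω s) *
            delClusterProb p ends t 𝓥₂ (cluster ends ω s) *
            (avoidAll ends s (X ∪ Y)).indicator 1 ω) := key
    _ ≤ prob p (clusterInEvent ends s (𝓤₁ ∩ 𝓤₂) ∩ clusterInEvent ends t (𝓦₁ ∩ 𝓦₂) ∩
          avoidAll ends s (X ∩ Y)) *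
        prob p (clusterInEvent ends t (𝓥₁ ∩ 𝓥₂) ∩ avoidAll ends s (X ∪ Y)) :=
        mul_le_mul eJ eM nM nJ

/-- **The cross-pair inequality** on `{s ↮ t}`:
`P(y ∈ C_s, z ∈ C_t, s↮{z,t}) · P(z ∈ C_s, y ∈ C_t, s↮{y,t})
  ≤ P(y, z ∈ C_s, s↮{z,t}∩{y,t}) · P(y, z ∈ C_t, s↮{z,t}∪{y,t})` — for distinct `y, z, t` this is
`m(ST) m(TS) ≤ m(SS) m(TT)` for the statuses of `(y, z)` on `{s ↮ t}`. -/
theorem cross_pair_lsm (p : E → R) (hp : IsProbVec p) (ends : E → Sym2 V) (s t y z : V) :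
    prob p (clusterInEvent ends s {K | y ∈ K} ∩ clusterInEvent ends t {L | z ∈ L} ∩
        avoidAll ends s {z, t}) *
      prob p (clusterInEvent ends s {K | z ∈ K} ∩ clusterInEvent ends t {L | y ∈ L} ∩
        avoidAll ends s {y, t}) ≤
    prob p (clusterInEvent ends s ({K | y ∈ K} ∩ {K | z ∈ K}) ∩
        avoidAll ends s ({z, t} ∩ {y, t})) *
      prob p (clusterInEvent ends t ({L | z ∈ L} ∩ {L | y ∈ L}) ∩
        avoidAll ends s ({z, t} ∪ {y, t})) := by
  have hup : ∀ v : V, IsUpperSet {K : Set V | v ∈ K} := fun v K K' h hK => h hK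
  exact bhk_two_cluster_four p hp ends s t (Finset.mem_insert_of_mem (Finset.mem_singleton_self t))
    (Finset.mem_insert_of_mem (Finset.mem_singleton_self t)) (hup y) (hup z) (hup z) (hup y)

end TwoClusterFour

end BHKAntitoneCross

end Summit.Ventures.PercRepro2
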